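import Literature.Probability.Percolation.SlabGluingFact2RouteExt
import HarnessLib

/-!
# DST 2016, §2.3, Fact 2 — explicit lattice paths for the zone surgeries

Topic: `Literature/Probability/Percolation`. Towards the verbatim discharge of
`DuminilCopinSidoraviciusTassion2016_fact2` (`SlabGluing.lean`). The link paths and branch tails fed
to `exists_route_linked` (`SlabGluingFact2RouteLink.lean`) by the zone surgeries are short explicit
lattice paths: a vertical run inside one column, an axis-parallel planar path with at most two
corners at a fixed height, and a final vertical run. This file builds them once, each with an
EXACT membership description (so that the disjointness side conditions of `exists_route_linked`
reduce to linear arithmetic at the call sites):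

* `onSeg a b z` — `z` lies in the coordinate box spanned by `a` and `b` (for `a`, `b` on a common
  row or column: the lattice segment between them); `exists_straight_ppath` — PROVED: the straight
  planar path between two such points, with membership `onSeg`;
* `exists_ppath3` — PROVED: the planar path through four corner points (consecutive ones on a
  common row or column, the three segments meeting only at the corners), with membership the union
  of the three `onSeg`;
* `exists_spath_vpv` — PROVED: in the slab, the vertical run over the first corner from height `h₀`
  to `h`, the lift of that planar path at height `h`, and the vertical run over the last corner from
  `h` to `h₃`: a self-avoiding lattice path with exact membership.

## Sources

* H. Duminil-Copin, V. Sidoravicius, V. Tassion, *Absence of infinite cluster for critical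
  Bernoulli percolation on slabs*, CPAM 69 (2016), arXiv:1401.7130, §2.3, proof of Fact 2 (the
  three disjoint self-avoiding paths in `\overline{B_R}(z) ∖ {z}`).
-/

noncomputable section

namespace Literature.Probability.Percolation

open LatticeModels SimpleGraph

variable {k : ℕ}

/-! ## Straight planar segments -/

/-- `z` lies in the coordinate box spanned by `a` and `b` — for `a`, `b` on a common row or column
this is the lattice segment between them. [folklore] -/
def onSeg (a b z : ℤ × ℤ) : Prop :=
  min a.1 b.1 ≤ z.1 ∧ z.1 ≤ max a.1 b.1 ∧ min a.2 b.2 ≤ z.2 ∧ z.2 ≤ max a.2 b.2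

/-- `onSeg` in linear-arithmetic form. [folklore] -/
theorem onSeg_iff (a b z : ℤ × ℤ) : onSeg a b z ↔
    (a.1 ≤ z.1 ∨ b.1 ≤ z.1) ∧ (z.1 ≤ a.1 ∨ z.1 ≤ b.1) ∧ (a.2 ≤ z.2 ∨ b.2 ≤ z.2) ∧ (z.2 ≤ a.2 ∨ z.2 ≤ b.2) := by
  simp only [onSeg, min_le_iff, le_max_iff]

/-- The ends lie on the segment. [folklore] -/
theorem onSeg_left (a b : ℤ × ℤ) : onSeg a b a := by
  rw [onSeg_iff]; omega

/-- The ends lie on the segment. [folklore] -/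
theorem onSeg_right (a b : ℤ × ℤ) : onSeg a b b := by
  rw [onSeg_iff]; omega

/-- PROVED — **the straight planar path** between two points of a common column or row, visiting
exactly the points of the segment. [folklore] -/
theorem exists_straight_ppath (a b : ℤ × ℤ) (hab : a.1 = b.1 ∨ a.2 = b.2) :
    ∃ l, PPath l a b ∧ ∀ z, z ∈ l ↔ onSeg a b z := by
  obtain ⟨a1, a2⟩ := a
  obtain ⟨b1, b2⟩ := b
  simp only at hab
  rcases hab with h | h
  · subst h
    obtain ⟨l, hl, hm⟩ := exists_vpath a1 a2 b2
    refine ⟨l, hl, fun z => ?_⟩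
    rw [hm, onSeg_iff]
    simp only [min_le_iff, le_max_iff]
    omega
  · subst h
    obtain ⟨l, hl, hm⟩ := exists_hpath a2 a1 b1
    refine ⟨l, hl, fun z => ?_⟩
    rw [hm, onSeg_iff]
    simp only [min_le_iff, le_max_iff]
    omega

/-- PROVED — **the planar path through four corners**: consecutive corners on a common column or
row, the second segment meeting the first only at `c₁` and the third meeting the first two only at
`c₂`; membership is the union of the three segments. [folklore] -/
theorem exists_ppath3 (c₀ c₁ c₂ c₃ : ℤ × ℤ) (h01 : c₀.1 = c₁.1 ∨ c₀.2 = c₁.2)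
    (h12 : c₁.1 = c₂.1 ∨ c₁.2 = c₂.2) (h23 : c₂.1 = c₃.1 ∨ c₂.2 = c₃.2)
    (hd1 : ∀ z, onSeg c₀ c₁ z → onSeg c₁ c₂ z → z = c₁)
    (hd2 : ∀ z, onSeg c₀ c₁ z ∨ onSeg c₁ c₂ z → onSeg c₂ c₃ z → z = c₂) :
    ∃ l, PPath l c₀ c₃ ∧ ∀ z, z ∈ l ↔ onSeg c₀ c₁ z ∨ onSeg c₁ c₂ z ∨ onSeg c₂ c₃ z := by
  obtain ⟨l₁, hl₁, hm₁⟩ := exists_straight_ppath c₀ c₁ h01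
  obtain ⟨l₂, hl₂, hm₂⟩ := exists_straight_ppath c₁ c₂ h12
  obtain ⟨l₃, hl₃, hm₃⟩ := exists_straight_ppath c₂ c₃ h23
  obtain ⟨hl₁₂, hm₁₂⟩ := hl₁.trans hl₂ fun z hz hz' => hd1 z ((hm₁ z).1 hz) ((hm₂ z).1 hz')
  obtain ⟨hl, hm⟩ := hl₁₂.trans hl₃ fun z hz hz' => by
    refine hd2 z ?_ ((hm₃ z).1 hz')
    rcases (hm₁₂ z).1 hz with h | h
    · exact Or.inl ((hm₁ z).1 h)
    · exact Or.inr ((hm₂ z).1 h)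
  refine ⟨_, hl, fun z => ?_⟩
  rw [hm, hm₁₂, hm₁, hm₂, hm₃, or_assoc]

/-! ## The slab path: vertical run, planar path at a fixed height, vertical run -/

/-- PROVED — **the slab path "vertical – planar – vertical"**: over the corner `c₀` from height `h₀`
to `h`, along the planar path of `exists_ppath3` at height `h`, over the last corner `c₃` from `h`
to `h₃` (`c₀ ≠ c₃`). A self-avoiding lattice path from `(h₀, c₀)` to `(h₃, c₃)` whose vertices are
exactly: those over `c₀` with height between `h₀` and `h`, those of height `h` over the three
segments, and those over `c₃` with height between `h` and `h₃`. [folklore] -/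
theorem exists_spath_vpv {h₀ h h₃ : ℕ} (hh₀ : h₀ ≤ k) (hh : h ≤ k) (hh₃ : h₃ ≤ k)
    (c₀ c₁ c₂ c₃ : ℤ × ℤ) (h01 : c₀.1 = c₁.1 ∨ c₀.2 = c₁.2)
    (h12 : c₁.1 = c₂.1 ∨ c₁.2 = c₂.2) (h23 : c₂.1 = c₃.1 ∨ c₂.2 = c₃.2)
    (hd1 : ∀ z, onSeg c₀ c₁ z → onSeg c₁ c₂ z → z = c₁)
    (hd2 : ∀ z, onSeg c₀ c₁ z ∨ onSeg c₁ c₂ z → onSeg c₂ c₃ z → z = c₂) (hc : c₀ ≠ c₃) :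
    ∃ ℓ : List (slab 3 k), SPath ℓ (vtx k c₀ h₀) (vtx k c₃ h₃) ∧
      ∀ v, v ∈ ℓ ↔ (planar k v = c₀ ∧ min h₀ h ≤ ht v ∧ ht v ≤ max h₀ h) ∨
        (ht v = h ∧ (onSeg c₀ c₁ (planar k v) ∨ onSeg c₁ c₂ (planar k v) ∨ onSeg c₂ c₃ (planar k v))) ∨
        (planar k v = c₃ ∧ min h h₃ ≤ ht v ∧ ht v ≤ max h h₃) := by
  obtain ⟨lp, hlp, hmp⟩ := exists_ppath3 c₀ c₁ c₂ c₃ h01 h12 h23 hd1 hd2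
  have hX := vline_spath (k := k) c₀ hh₀ hh
  have hY := liftH_spath (k := k) hlp h
  have hZ := vline_spath (k := k) c₃ hh hh₃
  have hmX : ∀ v, v ∈ vline k c₀ h₀ h ↔ planar k v = c₀ ∧ min h₀ h ≤ ht v ∧ ht v ≤ max h₀ h :=
    fun v => mem_vline_iff hh₀ hh v
  have hmY : ∀ v, v ∈ liftH k h lp ↔ (onSeg c₀ c₁ (planar k v) ∨ onSeg c₁ c₂ (planar k v) ∨
      onSeg c₂ c₃ (planar k v)) ∧ ht v = h := fun v => by rw [mem_liftH_iff hh, hmp]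
  have hmZ : ∀ v, v ∈ vline k c₃ h h₃ ↔ planar k v = c₃ ∧ min h h₃ ≤ ht v ∧ ht v ≤ max h h₃ :=
    fun v => mem_vline_iff hh hh₃ v
  obtain ⟨hP, hmP⟩ := SPath.trans3 hX hY hZ
    (fun v hvX hvY => by
      obtain ⟨hp, -, -⟩ := (hmX v).1 hvX
      obtain ⟨-, hv⟩ := (hmY v).1 hvY
      exact (slab_ext_iff _ _).2 ⟨by rw [planar_vtx]; exact hp, by rw [ht_vtx hh]; exact hv⟩)
    (fun v hv hvZ => by
      obtain ⟨hp, -, -⟩ := (hmZ v).1 hvZ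
      rcases hv with hv | hv
      · obtain ⟨hp', -, -⟩ := (hmX v).1 hv
        exact absurd (hp'.symm.trans hp) hc
      · obtain ⟨-, hv⟩ := (hmY v).1 hv
        exact (slab_ext_iff _ _).2 ⟨by rw [planar_vtx]; exact hp, by rw [ht_vtx hh]; exact hv⟩)
  refine ⟨_, hP, fun v => ?_⟩
  rw [hmP, hmX, hmY, hmZ]
  constructor
  · rintro (h1 | ⟨h1, h2⟩ | h1)
    · exact Or.inl h1
    · exact Or.inr (Or.inl ⟨h2, h1⟩)
    · exact Or.inr (Or.inr h1)
  · rintro (h1 | ⟨h1, h2⟩ | h1)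
    · exact Or.inl h1
    · exact Or.inr (Or.inl ⟨h2, h1⟩)
    · exact Or.inr (Or.inr h1)

end Literature.Probability.Percolation

end
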